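import Literature.MathematicalPhysics.QuantumFieldTheory.UnitaryCayleyChart
import Literature.MathematicalPhysics.QuantumFieldTheory.LatticeAxialGauge
import HarnessLib

/-!
# Weak-coupling bounds for `U(N)` lattice gauge theory on cubes (Chatterjee §§7, 8, 10, 16, 17)

Third step of the inline proof of the named fact
`Literature.MathematicalPhysics.QuantumFieldTheory.chatterjee_freeEnergyDensity`
(`LatticeGaugeAsymptotics.lean`), after `UnitaryCayleyChart` (the Cayley chart of `U(N)` and Haar
measure near `1`) and `LatticeAxialGauge` (axial gauge on cubes). Source: S. Chatterjee,
*The leading term of the Yang–Mills free energy*, J. Funct. Anal. 271 (2016), arXiv:1602.01222.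
Everything is proved; no named fact is introduced. Throughout `G = U(N)`
(`UnitaryCayley.𝔾 N`) with its defining representation, `S = S_{B_n}` is `Sweep1.zdWilsonAction`
on the cube `B_n = halfOpenBox d n` and `Z = Z(B_n, β)` is `Sweep1.zdPartitionFunction`.

* `UnitaryCayley.abs_re_trace_one_sub_cay_prod_sub_le`: **Lemma 16.2 for the Cayley chart** — for
  skew-Hermitian `Y₁,…,Y₄` of Frobenius norm `≤ η ≤ 1`,
  `|Re tr(1 - cay Y₁ cay Y₂ cay Y₃ cay Y₄) - ½‖Y₁+Y₂+Y₃+Y₄‖²| ≤ 67 N η³` (printed proof: expand the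
  four factors, `Re tr Yᵢ = 0`, `½ tr ΣYᵢ² + tr Σ_{i<j} YᵢYⱼ = ½ tr(ΣYᵢ)²`).
* `WilsonWeakCoupling.S_eq` (`S = ½ Σ_p ‖1 - U_p‖²`, Lemma 7.2), `norm_one_sub_sq_le_l1_mul_S`
  (**Lemma 10.2** for `U(N)`: `‖1 - U(x,j)‖² ≤ 2|x|₁ S` in axial gauge), `Z_eq`, `Z_le_one`.
* `exists_Z_ge`: **Theorem 7.1**, `Z(B_n, β) ≥ exp(-C n^d log β)` for `β ≥ 2` (with the soft small-ball
  constant of `UnitaryCayley.exists_haar_gball_ge`).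
* `Z_le_two_mul_setLIntegral`: **Cor. 8.2**, `Z ≤ 2 ∫_{βS ≤ C n^d log β + log 2} e^{-βS}`.
* `Z_le_two_mul_lintegral_free`: **Theorem 10.1**, `Z ≤ 2 ∫ 1_{‖1 - v_e‖ ≤ ρ₀ ∀e} e^{-βS(1,v)} dσ^{E_n^1}`
  with `ρ₀ = rho0 C d n β = (2dn(Cn^d log β + log 2)/β)^{1/2}` (Cor. 8.2 + Cor. 9.4 + Lemma 10.2).
* `zeroExt`, `circ`, `maxwell` (the matrix-valued Maxwell action `M_n(H) = Σ_p ‖H(p)‖²` of the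
  Lie-algebra configuration in the coordinates `ℝ^{N²}`), `abs_S_chart_sub_maxwell_le`
  (**Theorem 16.3** in the Cayley chart: `|S(chart ∘ H) - ½ M_n(H)| ≤ 67 N η³ |B_n'|`).
* `Z_le_gaussian` (**Lemma 17.2** up to the Gaussian integral:
  `Z ≤ 2 c_N^{|E_n^1|} e^{67βN(2ρ₀)³|B_n'|} ∫ e^{-βM_n(a)/2} da`, for `ρ₀ ≤ 1/8`) and `gaussian_le_Z`
  (**Lemma 17.6** up to the Gaussian estimates:
  `Z ≥ (c_N κ(r)^{-N²})^{|E_n^1|} e^{-67βNr³|B_n'|} ∫_{b(0,r)^{E_n^1}} e^{-βM_n(a)/2} da`, `0 < r ≤ 1/2`).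

Not here: the Gaussian (lattice Maxwell) theory of §§12–15, the scaling `a ↦ a/√β` and the final
assembly of §17 — the next files.

## References

* S. Chatterjee, *The leading term of the Yang–Mills free energy*, J. Funct. Anal. 271 (2016)
  2944–3005, arXiv:1602.01222, §7 (Thm. 7.1, Lemma 7.2), §8 (Thm. 8.1, Cor. 8.2), §10 (Thm. 10.1,
  Lemma 10.2), §16 (Lemmas 16.1, 16.2, Thm. 16.3), §17 (Lemmas 17.2, 17.6). [arXiv160201222]
-/

noncomputable section

open scoped Matrix.Norms.Frobenius ENNReal
open MeasureTheory Measure Finset Set Matrix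
open Literature.Probability.LatticeModels Literature.MathematicalPhysics.QuantumLattice

namespace Literature.MathematicalPhysics.QuantumFieldTheory

variable {d N : ℕ}

/-- Matrices `M_N(ℂ)` with the Frobenius norm. -/
local notation "𝕄" => Matrix (Fin N) (Fin N) ℂ

namespace UnitaryCayley

/-! ### Traces -/

/-- A skew-Hermitian matrix has purely imaginary trace. [folklore] -/
theorem re_trace_eq_zero_of_skew {Y : 𝕄} (hY : Yᴴ = -Y) : (trace Y).re = 0 := by
  have h := congrArg (fun M : 𝕄 => (trace M).re) hY
  simp only [trace_conjTranspose, trace_neg, Complex.neg_re, RCLike.star_def, Complex.conj_re] at h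
  linarith

/-- Entries are bounded by the Frobenius norm. [folklore] -/
theorem norm_entry_le (A : 𝕄) (i j : Fin N) : ‖A i j‖ ≤ ‖A‖ := by
  have h : ‖A i j‖ ^ 2 ≤ ‖A‖ ^ 2 := by
    rw [frobenius_norm_sq A]
    exact (Finset.single_le_sum (f := fun k => ‖A i k‖ ^ 2) (fun _ _ => sq_nonneg _) (Finset.mem_univ j)).trans
      (Finset.single_le_sum (f := fun l => ∑ k, ‖A l k‖ ^ 2) (fun _ _ => Finset.sum_nonneg fun _ _ => sq_nonneg _)
        (Finset.mem_univ i))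
  exact le_of_sq_le_sq (by simpa using h) (norm_nonneg _)

/-- `|Re tr A| ≤ N ‖A‖_F`. [folklore] -/
theorem abs_re_trace_le (A : 𝕄) : |(trace A).re| ≤ N * ‖A‖ := by
  calc |(trace A).re| ≤ ‖trace A‖ := Complex.abs_re_le_norm _
    _ = ‖∑ i, A i i‖ := rfl
    _ ≤ ∑ i, ‖A i i‖ := norm_sum_le _ _
    _ ≤ ∑ _i : Fin N, ‖A‖ := Finset.sum_le_sum fun i _ => norm_entry_le A i i
    _ = N * ‖A‖ := by rw [Finset.sum_const, Finset.card_univ, Fintype.card_fin, nsmul_eq_mul]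

/-- `-Re tr(Z²) = ‖Z‖²` for skew-Hermitian `Z`. [folklore] -/
theorem neg_re_trace_sq_of_skew {Z : 𝕄} (hZ : Zᴴ = -Z) : -(trace (Z * Z)).re = ‖Z‖ ^ 2 := by
  rw [Matrix.frobenius_norm_sq_eq_re_trace, hZ, neg_mul, trace_neg]
  simp

/-! ### Lemma 16.2 for the Cayley chart -/

/-- The product of four factors `1 + Tᵢ`, expanded. [folklore] -/
theorem expand_four (T₁ T₂ T₃ T₄ : 𝕄) :
    (1 + T₁) * (1 + T₂) * (1 + T₃) * (1 + T₄) =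
      1 + (T₁ + T₂ + T₃ + T₄) + (T₁ * T₂ + T₁ * T₃ + T₁ * T₄ + T₂ * T₃ + T₂ * T₄ + T₃ * T₄) +
        (T₁ * T₂ * T₃ + T₁ * T₂ * T₄ + T₁ * T₃ * T₄ + T₂ * T₃ * T₄ + T₁ * T₂ * T₃ * T₄) := by
  noncomm_ring

/-- `cay Y - 1 = Y + Y²/2 + R` with `‖R‖ ≤ ‖Y‖³/4`; hence `‖cay Y - 1 - Y‖ ≤ ‖Y‖²/2 + ‖Y‖³/4` and
`‖cay Y - 1‖ ≤ ‖Y‖ + ‖Y‖²/2 + ‖Y‖³/4`. [cite: arXiv160201222, Lemma 16.1 (analogue)] -/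
theorem norm_cay_sub_one_sub_le {Y : 𝕄} (hY : Yᴴ = -Y) :
    ‖cay Y - 1 - Y - (2 : ℂ)⁻¹ • (Y * Y)‖ ≤ ‖Y‖ ^ 3 / 4 := by
  have h := norm_cay_sub_taylor_le hY
  have e : cay Y - 1 - Y - (2 : ℂ)⁻¹ • (Y * Y) = cay Y - (1 + Y + (2 : ℂ)⁻¹ • (Y * Y)) := by abel
  rwa [e]

/-- `‖cay Y - 1 - Y‖ ≤ ‖Y‖²/2 + ‖Y‖³/4`. [cite: arXiv160201222, Lemma 16.1 (analogue)] -/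
theorem norm_cay_sub_one_sub_self_le {Y : 𝕄} (hY : Yᴴ = -Y) :
    ‖cay Y - 1 - Y‖ ≤ ‖Y‖ ^ 2 / 2 + ‖Y‖ ^ 3 / 4 := by
  have h := norm_cay_sub_one_sub_le hY
  have h2 : ‖(2 : ℂ)⁻¹ • (Y * Y)‖ ≤ ‖Y‖ ^ 2 / 2 := by
    rw [norm_smul]
    have : ‖(2 : ℂ)⁻¹‖ = 2⁻¹ := by simp
    rw [this]
    have := Matrix.frobenius_norm_mul Y Y
    nlinarith [norm_nonneg (Y * Y)]
  calc ‖cay Y - 1 - Y‖ = ‖(cay Y - 1 - Y - (2 : ℂ)⁻¹ • (Y * Y)) + (2 : ℂ)⁻¹ • (Y * Y)‖ := by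
        rw [sub_add_cancel]
    _ ≤ ‖Y‖ ^ 3 / 4 + ‖Y‖ ^ 2 / 2 := (norm_add_le _ _).trans (add_le_add h h2)
    _ = _ := by ring

/-- `‖cay Y - 1‖ ≤ ‖Y‖ + ‖Y‖²/2 + ‖Y‖³/4`. [cite: arXiv160201222, Lemma 16.1 (analogue)] -/
theorem norm_cay_sub_one_le {Y : 𝕄} (hY : Yᴴ = -Y) :
    ‖cay Y - 1‖ ≤ ‖Y‖ + ‖Y‖ ^ 2 / 2 + ‖Y‖ ^ 3 / 4 := by
  have h := norm_cay_sub_one_sub_self_le hY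
  calc ‖cay Y - 1‖ = ‖(cay Y - 1 - Y) + Y‖ := by rw [sub_add_cancel]
    _ ≤ (‖Y‖ ^ 2 / 2 + ‖Y‖ ^ 3 / 4) + ‖Y‖ := (norm_add_le _ _).trans (add_le_add h le_rfl)
    _ = _ := by ring

/-- **Lemma 16.2 for the Cayley chart**: for skew-Hermitian `Y₁, …, Y₄` of Frobenius norm `≤ η ≤ 1`,
`|Re tr(1 - cay Y₁ cay Y₂ cay Y₃ cay Y₄) - ½ ‖Y₁ + Y₂ + Y₃ + Y₄‖²| ≤ 67 N η³`
(Chatterjee arXiv:1602.01222 Lemma 16.2 proves `|φ(U(x,j,k)) - ½‖H(x,j,k)‖²| ≤ C η³` for the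
exponential chart; the proof — expand the four factors `1 + Tᵢ`, `Tᵢ = Yᵢ + Yᵢ²/2 + O(η³)`, use
`Re tr Yᵢ = 0` and `½ tr Σ Yᵢ² + tr Σ_{i<j} YᵢYⱼ = ½ tr (ΣYᵢ)²` — is the printed one). [cite: arXiv160201222, Lemma 16.2 (analogue)] -/
theorem abs_re_trace_one_sub_cay_prod_sub_le {Y₁ Y₂ Y₃ Y₄ : 𝕄} (h₁ : Y₁ᴴ = -Y₁) (h₂ : Y₂ᴴ = -Y₂)
    (h₃ : Y₃ᴴ = -Y₃) (h₄ : Y₄ᴴ = -Y₄) {η : ℝ} (hη : η ≤ 1) (hY₁ : ‖Y₁‖ ≤ η) (hY₂ : ‖Y₂‖ ≤ η)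
    (hY₃ : ‖Y₃‖ ≤ η) (hY₄ : ‖Y₄‖ ≤ η) :
    |(trace (1 - cay Y₁ * cay Y₂ * cay Y₃ * cay Y₄)).re - ‖Y₁ + Y₂ + Y₃ + Y₄‖ ^ 2 / 2| ≤
      67 * N * η ^ 3 := by
  have hη0 : 0 ≤ η := (norm_nonneg _).trans hY₁
  -- `Tᵢ = cay Yᵢ - 1`
  set T₁ := cay Y₁ - 1 with hT₁
  set T₂ := cay Y₂ - 1 with hT₂
  set T₃ := cay Y₃ - 1 with hT₃
  set T₄ := cay Y₄ - 1 with hT₄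
  -- bounds on `Tᵢ` and `Tᵢ - Yᵢ`
  have hT : ∀ {Y : 𝕄}, Yᴴ = -Y → ‖Y‖ ≤ η → ‖cay Y - 1‖ ≤ 2 * η := fun {Y} hY hYη => by
    have h := norm_cay_sub_one_le hY
    have : ‖Y‖ ^ 2 ≤ η * ‖Y‖ := by nlinarith [norm_nonneg Y]
    have : ‖Y‖ ^ 3 ≤ η * ‖Y‖ := by nlinarith [norm_nonneg Y]
    nlinarith [norm_nonneg Y]
  have hTY : ∀ {Y : 𝕄}, Yᴴ = -Y → ‖Y‖ ≤ η → ‖cay Y - 1 - Y‖ ≤ η ^ 2 := fun {Y} hY hYη => by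
    have h := norm_cay_sub_one_sub_self_le hY
    have h2 : ‖Y‖ ^ 2 ≤ η ^ 2 := pow_le_pow_left₀ (norm_nonneg _) hYη 2
    have h3 : ‖Y‖ ^ 3 ≤ η ^ 2 := by
      calc ‖Y‖ ^ 3 = ‖Y‖ ^ 2 * ‖Y‖ := by ring
        _ ≤ η ^ 2 * 1 := mul_le_mul h2 (hYη.trans hη) (norm_nonneg _) (sq_nonneg _)
        _ = η ^ 2 := mul_one _
    nlinarith
  have hR : ∀ {Y : 𝕄}, Yᴴ = -Y → ‖Y‖ ≤ η →
      |(trace (cay Y - 1)).re - (trace (Y * Y)).re / 2| ≤ N * η ^ 3 / 4 := fun {Y} hY hYη => by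
    have h := norm_cay_sub_one_sub_le hY
    have e : (trace (cay Y - 1)).re - (trace (Y * Y)).re / 2 =
        (trace (cay Y - 1 - Y - (2 : ℂ)⁻¹ • (Y * Y))).re := by
      simp only [trace_sub, trace_smul, Complex.sub_re, smul_eq_mul,
        re_trace_eq_zero_of_skew hY]
      norm_num; ring
    rw [e]
    refine (abs_re_trace_le _).trans ?_
    have h3 : ‖Y‖ ^ 3 ≤ η ^ 3 := pow_le_pow_left₀ (norm_nonneg _) hYη 3
    nlinarith [norm_nonneg (cay Y - 1 - Y - (2 : ℂ)⁻¹ • (Y * Y)), Nat.cast_nonneg (α := ℝ) N]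
  -- products
  have hP : ∀ {A B Ya Yb : 𝕄}, ‖A‖ ≤ 2 * η → ‖A - Ya‖ ≤ η ^ 2 → ‖Ya‖ ≤ η → ‖B‖ ≤ 2 * η →
      ‖B - Yb‖ ≤ η ^ 2 → |(trace (A * B)).re - (trace (Ya * Yb)).re| ≤ 3 * N * η ^ 3 := by
    intro A B Ya Yb hA hAY hYa hB hBY
    have e : (trace (A * B)).re - (trace (Ya * Yb)).re = (trace ((A - Ya) * B + Ya * (B - Yb))).re := by
      rw [← Complex.sub_re, ← trace_sub]; congr 2; noncomm_ring
    rw [e]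
    refine (abs_re_trace_le _).trans ?_
    have h1 : ‖(A - Ya) * B + Ya * (B - Yb)‖ ≤ η ^ 2 * (2 * η) + η * η ^ 2 :=
      (norm_add_le _ _).trans (add_le_add
        ((Matrix.frobenius_norm_mul _ _).trans (mul_le_mul hAY hB (norm_nonneg _) (sq_nonneg _)))
        ((Matrix.frobenius_norm_mul _ _).trans (mul_le_mul hYa hBY (norm_nonneg _) hη0)))
    have hN : (0 : ℝ) ≤ N := Nat.cast_nonneg N
    nlinarith
  have hC3 : ∀ {A B C : 𝕄}, ‖A‖ ≤ 2 * η → ‖B‖ ≤ 2 * η → ‖C‖ ≤ 2 * η →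
      |(trace (A * B * C)).re| ≤ 8 * N * η ^ 3 := by
    intro A B C hA hB hC
    refine (abs_re_trace_le _).trans ?_
    have h1 : ‖A * B * C‖ ≤ 2 * η * (2 * η) * (2 * η) :=
      (Matrix.frobenius_norm_mul _ _).trans (mul_le_mul ((Matrix.frobenius_norm_mul _ _).trans
        (mul_le_mul hA hB (norm_nonneg _) (by linarith))) hC (norm_nonneg _) (by positivity))
    have hN : (0 : ℝ) ≤ N := Nat.cast_nonneg N
    nlinarith
  have hC4 : ∀ {A B C D : 𝕄}, ‖A‖ ≤ 2 * η → ‖B‖ ≤ 2 * η → ‖C‖ ≤ 2 * η → ‖D‖ ≤ 2 * η →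
      |(trace (A * B * C * D)).re| ≤ 16 * N * η ^ 3 := by
    intro A B C D hA hB hC hD
    refine (abs_re_trace_le _).trans ?_
    have h1 : ‖A * B * C * D‖ ≤ 2 * η * (2 * η) * (2 * η) * (2 * η) :=
      (Matrix.frobenius_norm_mul _ _).trans (mul_le_mul
        ((Matrix.frobenius_norm_mul _ _).trans (mul_le_mul ((Matrix.frobenius_norm_mul _ _).trans
          (mul_le_mul hA hB (norm_nonneg _) (by linarith))) hC (norm_nonneg _) (by positivity)))
        hD (norm_nonneg _) (by positivity))
    have hN : (0 : ℝ) ≤ N := Nat.cast_nonneg N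
    have hη4 : η ^ 4 ≤ η ^ 3 := by
      calc η ^ 4 = η ^ 3 * η := by ring
        _ ≤ η ^ 3 * 1 := by gcongr
        _ = η ^ 3 := mul_one _
    nlinarith
  -- the expansion
  have hW : cay Y₁ * cay Y₂ * cay Y₃ * cay Y₄ = (1 + T₁) * (1 + T₂) * (1 + T₃) * (1 + T₄) := by
    simp [hT₁, hT₂, hT₃, hT₄]
  rw [hW, expand_four]
  have e1 : ∀ L P Q : 𝕄, (1 : 𝕄) - (1 + L + P + Q) = -(L + P + Q) := fun L P Q => by abel
  rw [e1]
  -- the quadratic main term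
  have hZ : (Y₁ + Y₂ + Y₃ + Y₄)ᴴ = -(Y₁ + Y₂ + Y₃ + Y₄) := by
    simp only [conjTranspose_add, h₁, h₂, h₃, h₄]; abel
  have hmain : ‖Y₁ + Y₂ + Y₃ + Y₄‖ ^ 2 / 2 =
      -((trace (Y₁ * Y₁)).re + (trace (Y₂ * Y₂)).re + (trace (Y₃ * Y₃)).re + (trace (Y₄ * Y₄)).re) / 2 -
        ((trace (Y₁ * Y₂)).re + (trace (Y₁ * Y₃)).re + (trace (Y₁ * Y₄)).re + (trace (Y₂ * Y₃)).re +
          (trace (Y₂ * Y₄)).re + (trace (Y₃ * Y₄)).re) := by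
    rw [← neg_re_trace_sq_of_skew hZ]
    have e : (Y₁ + Y₂ + Y₃ + Y₄) * (Y₁ + Y₂ + Y₃ + Y₄) =
        (Y₁ * Y₁ + Y₂ * Y₂ + Y₃ * Y₃ + Y₄ * Y₄) + (Y₁ * Y₂ + Y₂ * Y₁) + (Y₁ * Y₃ + Y₃ * Y₁) +
          (Y₁ * Y₄ + Y₄ * Y₁) + (Y₂ * Y₃ + Y₃ * Y₂) + (Y₂ * Y₄ + Y₄ * Y₂) + (Y₃ * Y₄ + Y₄ * Y₃) := by
      noncomm_ring
    rw [e]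
    simp only [trace_add, Complex.add_re, trace_mul_comm Y₂ Y₁, trace_mul_comm Y₃ Y₁, trace_mul_comm Y₄ Y₁,
      trace_mul_comm Y₃ Y₂, trace_mul_comm Y₄ Y₂, trace_mul_comm Y₄ Y₃]
    ring
  rw [hmain]
  simp only [trace_neg, trace_add, Complex.neg_re, Complex.add_re]
  -- the fifteen elementary bounds
  have bT₁ := hT h₁ hY₁; have bT₂ := hT h₂ hY₂; have bT₃ := hT h₃ hY₃; have bT₄ := hT h₄ hY₄
  have dT₁ := hTY h₁ hY₁; have dT₂ := hTY h₂ hY₂; have dT₃ := hTY h₃ hY₃; have dT₄ := hTY h₄ hY₄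
  have r₁ := abs_le.1 (hR h₁ hY₁); have r₂ := abs_le.1 (hR h₂ hY₂)
  have r₃ := abs_le.1 (hR h₃ hY₃); have r₄ := abs_le.1 (hR h₄ hY₄)
  have p₁₂ := abs_le.1 (hP bT₁ dT₁ hY₁ bT₂ dT₂); have p₁₃ := abs_le.1 (hP bT₁ dT₁ hY₁ bT₃ dT₃)
  have p₁₄ := abs_le.1 (hP bT₁ dT₁ hY₁ bT₄ dT₄); have p₂₃ := abs_le.1 (hP bT₂ dT₂ hY₂ bT₃ dT₃)
  have p₂₄ := abs_le.1 (hP bT₂ dT₂ hY₂ bT₄ dT₄); have p₃₄ := abs_le.1 (hP bT₃ dT₃ hY₃ bT₄ dT₄)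
  have c₁₂₃ := abs_le.1 (hC3 bT₁ bT₂ bT₃); have c₁₂₄ := abs_le.1 (hC3 bT₁ bT₂ bT₄)
  have c₁₃₄ := abs_le.1 (hC3 bT₁ bT₃ bT₄); have c₂₃₄ := abs_le.1 (hC3 bT₂ bT₃ bT₄)
  have c₁₂₃₄ := abs_le.1 (hC4 bT₁ bT₂ bT₃ bT₄)
  simp only [hT₁, hT₂, hT₃, hT₄]
  refine abs_le.2 ⟨?_, ?_⟩ <;> linarith [r₁.1, r₁.2, r₂.1, r₂.2, r₃.1, r₃.2, r₄.1, r₄.2, p₁₂.1, p₁₂.2,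
    p₁₃.1, p₁₃.2, p₁₄.1, p₁₄.2, p₂₃.1, p₂₃.2, p₂₄.1, p₂₄.2, p₃₄.1, p₃₄.2, c₁₂₃.1, c₁₂₃.2,
    c₁₂₄.1, c₁₂₄.2, c₁₃₄.1, c₁₃₄.2, c₂₃₄.1, c₂₃₄.2, c₁₂₃₄.1, c₁₂₃₄.2]

end UnitaryCayley

namespace WilsonWeakCoupling

open UnitaryCayley AxialGauge

/-- Sites of `ℤ^d`. -/
local notation "ZSite" => Literature.Probability.LatticeModels.Site

/-- The defining representation of `U(N)` (the inclusion into matrices). -/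
local notation "ι" => unitaryFundamentalRep (Fin N) ℂ

/-! ### The Wilson action of `U(N)` in Hilbert–Schmidt form -/

variable (d N) in
/-- The Wilson action `S_{B_n}(U) = Σ_{p ∈ B_n'} (N - Re tr U_p)` of the cube `B_n` for `U(N)`
(Chatterjee arXiv:1602.01222 eq. (2.2), `Sweep1.zdWilsonAction` for the defining representation). [cite: arXiv160201222, §2] -/
abbrev S (n : ℕ) (U : ZdGaugeConfig d (𝔾 N)) : ℝ :=
  zdWilsonAction (unitaryFundamentalRep (Fin N) ℂ) (halfOpenBox d n) U

/-- `N - Re tr U = Re tr (1 - U) = ½ ‖1 - U‖²` (Lemma 7.2). [cite: arXiv160201222, Lemma 7.2] -/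
theorem sub_re_trace_eq (U : 𝔾 N) : (N : ℝ) - ((U : 𝕄).trace).re = ‖(1 : 𝕄) - U‖ ^ 2 / 2 := by
  rw [← re_trace_one_sub U.2, Matrix.trace_sub, Complex.sub_re, Matrix.trace_one, Fintype.card_fin]
  simp

/-- **The Wilson action in Hilbert–Schmidt form**: `S_{B_n}(U) = ½ Σ_p ‖1 - U_p‖²`. [cite: arXiv160201222, Lemma 7.2] -/
theorem S_eq (n : ℕ) (U : ZdGaugeConfig d (𝔾 N)) :
    S d N n U = ∑ p ∈ plaquettesIn (halfOpenBox d n), ‖(1 : 𝕄) - (U.plaquette p.1 p.2.1 p.2.2 : 𝔾 N)‖ ^ 2 / 2 := by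
  unfold S zdWilsonAction
  exact Finset.sum_congr rfl fun p _ => by rw [unitaryFundamentalRep_apply, sub_re_trace_eq]

/-- `S ≥ 0`. [cite: arXiv160201222, §4] -/
theorem S_nonneg (n : ℕ) (U : ZdGaugeConfig d (𝔾 N)) : 0 ≤ S d N n U := by
  rw [S_eq]; exact Finset.sum_nonneg fun _ _ => by positivity

/-- `‖U‖_F² = N` for unitary `U`. [folklore] -/
theorem norm_coe_sq (U : 𝔾 N) : ‖(U : 𝕄)‖ ^ 2 = N := by
  rw [Matrix.frobenius_norm_sq_eq_re_trace, ← star_eq_conjTranspose,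
    Matrix.mem_unitaryGroup_iff'.1 U.2, Matrix.trace_one, Fintype.card_fin]
  simp

/-- `‖1 - U‖² ≤ 4N`, i.e. `N - Re tr U ≤ 2N`. [cite: arXiv160201222, §17 (range of φ)] -/
theorem norm_one_sub_sq_le (U : 𝔾 N) : ‖(1 : 𝕄) - U‖ ^ 2 ≤ 4 * (N : ℝ) := by
  have h1 : ‖(1 : 𝕄)‖ ^ 2 = N := by simpa using norm_coe_sq (1 : 𝔾 N)
  have h2 := norm_coe_sq U
  have hle : ‖(1 : 𝕄) - U‖ ≤ ‖(1 : 𝕄)‖ + ‖(U : 𝕄)‖ := norm_sub_le _ _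
  have hN : (0 : ℝ) ≤ N := Nat.cast_nonneg N
  have ha : ‖(1 : 𝕄)‖ = Real.sqrt N := by rw [← h1, Real.sqrt_sq (norm_nonneg _)]
  have hb : ‖(U : 𝕄)‖ = Real.sqrt N := by rw [← h2, Real.sqrt_sq (norm_nonneg _)]
  calc ‖(1 : 𝕄) - U‖ ^ 2 ≤ (‖(1 : 𝕄)‖ + ‖(U : 𝕄)‖) ^ 2 := by gcongr
    _ = 4 * (N : ℝ) := by rw [ha, hb, ← two_mul, mul_pow, Real.sq_sqrt hN]; ring

/-- `S_{B_n}(U) ≤ 2N |B_n'| ≤ 2N d² n^d`. [cite: arXiv160201222, §17] -/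
theorem S_le (n : ℕ) (U : ZdGaugeConfig d (𝔾 N)) : S d N n U ≤ 2 * N * (d * d * n ^ d : ℕ) := by
  rw [S_eq]
  calc ∑ p ∈ plaquettesIn (halfOpenBox d n), ‖(1 : 𝕄) - (U.plaquette p.1 p.2.1 p.2.2 : 𝔾 N)‖ ^ 2 / 2
      ≤ ∑ _p ∈ plaquettesIn (halfOpenBox d n), (2 * N : ℝ) :=
        Finset.sum_le_sum fun p _ => by linarith [norm_one_sub_sq_le (U.plaquette p.1 p.2.1 p.2.2)]
    _ = #(plaquettesIn (halfOpenBox d n)) * (2 * N) := by rw [Finset.sum_const, nsmul_eq_mul]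
    _ ≤ (d * d * n ^ d : ℕ) * (2 * N) := by gcongr; exact_mod_cast card_plaquettesIn_le n
    _ = 2 * N * (d * d * n ^ d : ℕ) := by ring

/-- The Wilson action of the box as a function of box configurations is continuous. [folklore] -/
theorem continuous_S_ext (n : ℕ) : Continuous fun u : BoxCfg d (𝔾 N) n => S d N n (ext u) :=
  (AreaLaw.continuous_zdWilsonAction ι (continuous_unitaryFundamentalRep (Fin N) ℂ) _).comp
    (continuous_pi fun e => by
      by_cases h : e ∈ boxEdges d n
      · simp only [AxialGauge.ext, dif_pos h]; exact continuous_apply _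
      · simp only [AxialGauge.ext, dif_neg h]; exact continuous_const)

/-- … hence measurable. [folklore] -/
theorem measurable_S_ext (n : ℕ) : Measurable fun u : BoxCfg d (𝔾 N) n => S d N n (ext u) :=
  (continuous_S_ext n).measurable

/-! ### Lemma 10.2 for `U(N)` -/

/-- **Lemma 10.2 (discrete nonlinear Poincaré inequality for `U(N)`)**: for a configuration `U` on
`B_n` in axial gauge (`U = 1` on the comb tree) and every edge `(x, j)` of `B_n`,
`‖1 - U(x,j)‖² ≤ 2 |x|₁ S_{B_n}(U)`. [cite: arXiv160201222, Lemma 10.2] -/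
theorem norm_one_sub_sq_le_l1_mul_S {n : ℕ} (v : FreeCfg d (𝔾 N) n) {e : ZdEdge d}
    (he : e ∈ boxEdges d n) :
    ‖(1 : 𝕄) - (ext (ext₁ v) e : 𝔾 N)‖ ^ 2 ≤ 2 * l1 e.1 * S d N n (ext (ext₁ v)) := by
  have h := sq_le_l1_mul_sum (G := 𝔾 N) (ℓ := fun U : 𝔾 N => ‖(1 : 𝕄) - U‖) (fun _ => norm_nonneg _)
    (fun a b => norm_one_sub_mul_le a b) (fun a => norm_one_sub_inv a) (n := n) (U := ext (ext₁ v))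
    (fun e' he' hc => by
      show ‖(1 : 𝕄) - (ext (ext₁ v) e' : 𝔾 N)‖ = 0
      rw [ext_apply_of_mem _ he', ext₁_apply_of_isComb _ hc]; simp) he
  rw [S_eq]
  calc ‖(1 : 𝕄) - (ext (ext₁ v) e : 𝔾 N)‖ ^ 2
      ≤ l1 e.1 * ∑ p ∈ plaquettesIn (halfOpenBox d n),
          ‖(1 : 𝕄) - ((ext (ext₁ v)).plaquette p.1 p.2.1 p.2.2 : 𝔾 N)‖ ^ 2 := h
    _ = 2 * l1 e.1 * ∑ p ∈ plaquettesIn (halfOpenBox d n),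
          ‖(1 : 𝕄) - ((ext (ext₁ v)).plaquette p.1 p.2.1 p.2.2 : 𝔾 N)‖ ^ 2 / 2 := by
        rw [← Finset.sum_div]; ring

/-! ### Theorem 7.1: a lower bound for the partition function -/

variable (d N) in
/-- The partition function `Z(B_n, β)` of `U(N)` lattice gauge theory on the cube `B_n`
(`Sweep1.zdPartitionFunction` for the defining representation), in `[0, ∞]`. [cite: arXiv160201222, §2] -/
abbrev Z (n : ℕ) (β : ℝ) : ℝ≥0∞ := zdPartitionFunction (d := d) ι β (halfOpenBox d n)

/-- `Z(B_n, β)` as an integral over `U(N)^{E_n}`. [cite: arXiv160201222, §2] -/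
theorem Z_eq (n : ℕ) (β : ℝ) :
    Z d N n β = ∫⁻ u, ENNReal.ofReal (Real.exp (-β * S d N n (ext u)))
      ∂(Measure.pi fun _ : ↥(boxEdges d n) => haarProbability (𝔾 N)) :=
  zdPartitionFunction_eq_lintegral_pi ι (continuous_unitaryFundamentalRep (Fin N) ℂ) β n

/-- `Z(B_n, β) ≤ 1` for `β ≥ 0`. [cite: arXiv160201222, §17] -/
theorem Z_le_one (n : ℕ) {β : ℝ} (hβ : 0 ≤ β) : Z d N n β ≤ 1 := by
  rw [Z_eq]
  calc ∫⁻ u, ENNReal.ofReal (Real.exp (-β * S d N n (ext u))) ∂(Measure.pi fun _ => haarProbability (𝔾 N))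
      ≤ ∫⁻ _u, 1 ∂(Measure.pi fun _ : ↥(boxEdges d n) => haarProbability (𝔾 N)) :=
        lintegral_mono fun u => ENNReal.ofReal_le_one.2 (Real.exp_le_one_iff.2 (by
          have := S_nonneg n (ext u); nlinarith))
    _ = 1 := by rw [lintegral_const, measure_univ, mul_one]

/-- On the product ball `{‖1 - U_e‖ ≤ δ ∀ e}`, every plaquette holonomy is within `4δ` of `1` and
`S_{B_n} ≤ 8 δ² |B_n'|` (proof of Thm. 7.1). [cite: arXiv160201222, Thm. 7.1 (proof)] -/
theorem S_ext_le_of_mem_pi_gball {n : ℕ} {δ : ℝ} {u : BoxCfg d (𝔾 N) n}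
    (hu : u ∈ Set.pi Set.univ fun _ => gball N δ) :
    S d N n (ext u) ≤ 8 * δ ^ 2 * #(plaquettesIn (halfOpenBox d n)) := by
  rw [S_eq]
  have hball : ∀ {e : ZdEdge d}, e ∈ boxEdges d n → ‖(1 : 𝕄) - (ext u e : 𝔾 N)‖ ≤ δ := by
    intro e he
    rw [ext_apply_of_mem _ he, ← norm_neg, neg_sub]
    exact hu ⟨e, he⟩ (Set.mem_univ _)
  calc ∑ p ∈ plaquettesIn (halfOpenBox d n), ‖(1 : 𝕄) - ((ext u).plaquette p.1 p.2.1 p.2.2 : 𝔾 N)‖ ^ 2 / 2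
      ≤ ∑ _p ∈ plaquettesIn (halfOpenBox d n), (4 * δ) ^ 2 / 2 := by
        refine Finset.sum_le_sum fun p hp => ?_
        obtain ⟨h1, h2, h3, h4⟩ := edges_mem_boxEdges hp
        have hw := norm_one_sub_plaquetteWord_le (ext u (p.1, p.2.1)) (ext u (p.1 + Pi.single p.2.1 1, p.2.2))
          (ext u (p.1 + Pi.single p.2.2 1, p.2.1)) (ext u (p.1, p.2.2))
        have hle : ‖(1 : 𝕄) - ((ext u).plaquette p.1 p.2.1 p.2.2 : 𝔾 N)‖ ≤ 4 * δ := by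
          refine hw.trans ?_
          linarith [hball h1, hball h2, hball h3, hball h4]
        gcongr
    _ = 8 * δ ^ 2 * #(plaquettesIn (halfOpenBox d n)) := by
        rw [Finset.sum_const, nsmul_eq_mul]; ring

/-- `|E_n| ≤ d n^d`. [folklore] -/
theorem card_boxEdges_le (n : ℕ) : #(boxEdges d n) ≤ d * n ^ d := by
  calc #(boxEdges d n) ≤ #(halfOpenBox d n ×ˢ (Finset.univ : Finset (Fin d))) := Finset.card_filter_le _ _
    _ = d * n ^ d := by
        rw [Finset.card_product, card_halfOpenBox, Finset.card_univ, Fintype.card_fin, mul_comm]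

/-- **Theorem 7.1 (lower bound for the partition function)**: there is `C = C(N, d) > 0` with
`Z(B_n, β) ≥ exp(-C n^d log β)` for all `n` and all `β ≥ 2`. Proof as printed: restrict to the
product of Hilbert–Schmidt balls of radius `δ = (8β)^{-1/2}` around `1`, where `β S ≤ |B_n'|`, and
use the small-ball bound `σ(B(1,δ)) ≥ C₁ δ^{N²}` (`UnitaryCayley.exists_haar_gball_ge`, the soft
form of Cor. 6.3). [cite: arXiv160201222, Thm. 7.1] -/
theorem exists_Z_ge : ∃ C : ℝ, 0 < C ∧ ∀ (n : ℕ) (β : ℝ), 2 ≤ β →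
    ENNReal.ofReal (Real.exp (-(C * n ^ d * Real.log β))) ≤ Z d N n β := by
  obtain ⟨C₁, hC₁, hball⟩ := exists_haar_gball_ge (N := N)
  -- the constant
  set A : ℝ := d * d - d * Real.log C₁ + d * N ^ 2 / 2 * Real.log 8 with hA
  set C : ℝ := d * N ^ 2 / 2 + max A 0 / Real.log 2 + 1 with hC
  have hlog2 : 0 < Real.log 2 := Real.log_pos one_lt_two
  have hCpos : 0 < C := by positivity
  refine ⟨C, hCpos, fun n β hβ => ?_⟩
  have hβ0 : 0 < β := by linarith
  -- the radius
  set δ : ℝ := (Real.sqrt (8 * β))⁻¹ with hδ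
  have h8β : 0 < 8 * β := by linarith
  have hδpos : 0 < δ := inv_pos.2 (Real.sqrt_pos.2 h8β)
  have hδsq : δ ^ 2 = (8 * β)⁻¹ := by rw [hδ, inv_pow, Real.sq_sqrt h8β.le]
  have hδ1 : δ ≤ 1 := by
    rw [hδ]
    apply inv_le_one_of_one_le₀
    rw [show (1 : ℝ) = Real.sqrt 1 by simp]
    exact Real.sqrt_le_sqrt (by linarith)
  -- the product ball and the bound on it
  set E := boxEdges d n with hE
  set π := Measure.pi fun _ : ↥E => haarProbability (𝔾 N) with hπ
  set T : Set (BoxCfg d (𝔾 N) n) := Set.pi Set.univ fun _ => gball N δ with hT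
  set P := #(plaquettesIn (halfOpenBox d n)) with hP
  have hST : ∀ u ∈ T, ENNReal.ofReal (Real.exp (-(P : ℝ))) ≤
      ENNReal.ofReal (Real.exp (-β * S d N n (ext u))) := fun u hu => by
    apply ENNReal.ofReal_le_ofReal
    apply Real.exp_le_exp.2
    have h := S_ext_le_of_mem_pi_gball hu
    have : β * S d N n (ext u) ≤ β * (8 * δ ^ 2 * P) := mul_le_mul_of_nonneg_left h hβ0.le
    rw [hδsq] at this
    have e : β * (8 * (8 * β)⁻¹ * (P : ℝ)) = P := by field_simp
    linarith
  have hTmeas : MeasurableSet T := MeasurableSet.univ_pi fun _ => measurableSet_gball δ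
  -- measure of the product ball
  have hπT : (ENNReal.ofReal (C₁ * δ ^ (N * N))) ^ (d * n ^ d) ≤ π T := by
    rw [hπ, hT, Measure.pi_pi, Finset.prod_const, Finset.card_univ, Fintype.card_coe]
    have hx1 : ENNReal.ofReal (C₁ * δ ^ (N * N)) ≤ 1 :=
      (hball δ hδpos hδ1).trans prob_le_one
    calc (ENNReal.ofReal (C₁ * δ ^ (N * N))) ^ (d * n ^ d)
        ≤ (ENNReal.ofReal (C₁ * δ ^ (N * N))) ^ #E := pow_le_pow_right_of_le_one' hx1 (card_boxEdges_le n)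
      _ ≤ (haarProbability (𝔾 N) (gball N δ)) ^ #E := by gcongr; exact hball δ hδpos hδ1
  -- assemble in `ℝ≥0∞`
  have hmain : ENNReal.ofReal (Real.exp (-(P : ℝ))) * (ENNReal.ofReal (C₁ * δ ^ (N * N))) ^ (d * n ^ d) ≤ Z d N n β := by
    rw [Z_eq]
    calc ENNReal.ofReal (Real.exp (-(P : ℝ))) * (ENNReal.ofReal (C₁ * δ ^ (N * N))) ^ (d * n ^ d)
        ≤ ENNReal.ofReal (Real.exp (-(P : ℝ))) * π T := by gcongr
      _ = ∫⁻ _u in T, ENNReal.ofReal (Real.exp (-(P : ℝ))) ∂π := by rw [setLIntegral_const]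
      _ ≤ ∫⁻ u in T, ENNReal.ofReal (Real.exp (-β * S d N n (ext u))) ∂π :=
          setLIntegral_mono ((ENNReal.measurable_ofReal.comp (Real.measurable_exp.comp
            ((measurable_S_ext n).const_mul _)))) hST
      _ ≤ ∫⁻ u, ENNReal.ofReal (Real.exp (-β * S d N n (ext u))) ∂π := setLIntegral_le_lintegral _ _
  refine le_trans ?_ hmain
  -- the real-number inequality `exp(-C n^d log β) ≤ exp(-P) (C₁ δ^{N²})^{d n^d}`
  have hx : 0 < C₁ * δ ^ (N * N) := by positivity
  rw [← ENNReal.ofReal_pow hx.le, ← ENNReal.ofReal_mul (Real.exp_pos _).le]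
  apply ENNReal.ofReal_le_ofReal
  rw [← Real.exp_log (pow_pos hx (d * n ^ d)), ← Real.exp_add, Real.exp_le_exp, Real.log_pow,
    Real.log_mul hC₁.ne' (pow_pos hδpos _).ne', Real.log_pow]
  have hlogδ : Real.log δ = -(Real.log 8 + Real.log β) / 2 := by
    rw [hδ, Real.log_inv, Real.log_sqrt h8β.le, Real.log_mul (by norm_num) hβ0.ne']
    ring
  rw [hlogδ]
  have hPle : (P : ℝ) ≤ d * d * (n : ℝ) ^ d := by exact_mod_cast card_plaquettesIn_le n
  have hLβ : Real.log 2 ≤ Real.log β := Real.log_le_log two_pos hβ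
  have hnd : (0 : ℝ) ≤ (n : ℝ) ^ d := by positivity
  have hmax : A ≤ max A 0 / Real.log 2 * Real.log β := by
    calc A ≤ max A 0 := le_max_left _ _
      _ = max A 0 / Real.log 2 * Real.log 2 := by field_simp
      _ ≤ max A 0 / Real.log 2 * Real.log β := by gcongr
  -- `-C n^d log β ≤ -P + d n^d (log C₁ + N² (-(log 8 + log β)/2))`
  have key : C * (n : ℝ) ^ d * Real.log β ≥
      d * d * (n : ℝ) ^ d - (d * n ^ d : ℕ) * (Real.log C₁ + (N * N : ℕ) * (-(Real.log 8 + Real.log β) / 2)) := by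
    push_cast
    have e : (d : ℝ) * d * (n : ℝ) ^ d - d * (n : ℝ) ^ d * (Real.log C₁ + N * N * (-(Real.log 8 + Real.log β) / 2))
        = (n : ℝ) ^ d * (A + d * N ^ 2 / 2 * Real.log β) := by rw [hA]; ring
    rw [e, ge_iff_le, show C * (n : ℝ) ^ d * Real.log β = (n : ℝ) ^ d * (C * Real.log β) by ring]
    apply mul_le_mul_of_nonneg_left _ hnd
    rw [hC]
    nlinarith [hmax, hLβ, hlog2]
  linarith

/-! ### Corollary 8.2 and Theorem 10.1 -/

/-- **Cor. 8.2 (reduction to nearly minimising configurations)**: with `C` as in Thm. 7.1, for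
`β ≥ 2`, `Z(B_n, β) ≤ 2 ∫_{β S ≤ C n^d log β + log 2} e^{-β S} dσ_{B_n}`. (Printed with the set
`{β S ≤ C₀ n^d log β}`; the direct proof: off that set the integrand is `< e^{-C n^d log β}/2 ≤ Z/2`.) [cite: arXiv160201222, Cor. 8.2] -/
theorem Z_le_two_mul_setLIntegral {C : ℝ}
    (hC : ∀ (n : ℕ) (β : ℝ), 2 ≤ β → ENNReal.ofReal (Real.exp (-(C * n ^ d * Real.log β))) ≤ Z d N n β)
    (n : ℕ) {β : ℝ} (hβ : 2 ≤ β) :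
    Z d N n β ≤ 2 * ∫⁻ u in {u | β * S d N n (ext u) ≤ C * n ^ d * Real.log β + Real.log 2},
      ENNReal.ofReal (Real.exp (-β * S d N n (ext u))) ∂(Measure.pi fun _ : ↥(boxEdges d n) => haarProbability (𝔾 N)) := by
  set π := Measure.pi fun _ : ↥(boxEdges d n) => haarProbability (𝔾 N) with hπ
  set A := {u : BoxCfg d (𝔾 N) n | β * S d N n (ext u) ≤ C * n ^ d * Real.log β + Real.log 2} with hA
  set f := fun u : BoxCfg d (𝔾 N) n => ENNReal.ofReal (Real.exp (-β * S d N n (ext u))) with hf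
  have hAm : MeasurableSet A :=
    measurableSet_le ((measurable_S_ext n).const_mul β) measurable_const
  have hZfin : Z d N n β ≠ ∞ := ne_top_of_le_ne_top ENNReal.one_ne_top (Z_le_one n (by linarith))
  -- off `A` the integrand is small
  have hcompl : ∫⁻ u in Aᶜ, f u ∂π ≤ Z d N n β / 2 := by
    have hb : ∀ u ∈ Aᶜ, f u ≤ ENNReal.ofReal (Real.exp (-(C * n ^ d * Real.log β))) / 2 := by
      intro u hu
      simp only [hA, Set.mem_compl_iff, Set.mem_setOf_eq, not_le] at hu
      rw [hf]
      dsimp only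
      rw [show ENNReal.ofReal (Real.exp (-(C * n ^ d * Real.log β))) / 2 =
          ENNReal.ofReal (Real.exp (-(C * n ^ d * Real.log β)) / 2) by
        rw [ENNReal.ofReal_div_of_pos two_pos]; norm_num]
      apply ENNReal.ofReal_le_ofReal
      rw [div_eq_mul_inv, ← Real.exp_log two_pos, ← Real.exp_neg, ← Real.exp_add]
      exact Real.exp_le_exp.2 (by linarith)
    calc ∫⁻ u in Aᶜ, f u ∂π ≤ ∫⁻ _u in Aᶜ, ENNReal.ofReal (Real.exp (-(C * n ^ d * Real.log β))) / 2 ∂π :=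
          setLIntegral_mono measurable_const hb
      _ = ENNReal.ofReal (Real.exp (-(C * n ^ d * Real.log β))) / 2 * π Aᶜ := setLIntegral_const _ _
      _ ≤ ENNReal.ofReal (Real.exp (-(C * n ^ d * Real.log β))) / 2 * 1 := by gcongr; exact prob_le_one
      _ ≤ Z d N n β / 2 := by rw [mul_one]; exact ENNReal.div_le_div_right (hC n β hβ) 2
  have hsplit : Z d N n β = ∫⁻ u in A, f u ∂π + ∫⁻ u in Aᶜ, f u ∂π := by
    rw [Z_eq, ← hπ, lintegral_add_compl f hAm]
  have h1 : Z d N n β ≤ ∫⁻ u in A, f u ∂π + Z d N n β / 2 := by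
    conv_lhs => rw [hsplit]
    gcongr
  have h2 : Z d N n β / 2 ≤ ∫⁻ u in A, f u ∂π := by
    have h := h1
    conv_lhs at h => rw [← ENNReal.add_halves (Z d N n β)]
    exact ENNReal.le_of_add_le_add_right (ENNReal.div_ne_top hZfin two_ne_zero) h
  calc Z d N n β = 2 * (Z d N n β / 2) := (ENNReal.mul_div_cancel two_ne_zero ENNReal.ofNat_ne_top).symm
    _ ≤ 2 * ∫⁻ u in A, f u ∂π := by gcongr

/-- The radius `ρ₀ = (2 d n (C n^d log β + log 2) / β)^{1/2}` of Theorem 10.1 (printed as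
`C₁ n^{(d+1)/2} (log β / β)^{1/2}`). [cite: arXiv160201222, Thm. 10.1] -/
def rho0 (C : ℝ) (d n : ℕ) (β : ℝ) : ℝ := Real.sqrt (2 * d * n * (C * n ^ d * Real.log β + Real.log 2) / β)

/-- `ρ₀ ≥ 0`. [folklore] -/
theorem rho0_nonneg (C : ℝ) (d n : ℕ) (β : ℝ) : 0 ≤ rho0 C d n β := Real.sqrt_nonneg _

/-- **Theorem 10.1 (upper bound: reduction to a neighbourhood of the identity in axial gauge)**:
with `C` as in Thm. 7.1 and `ρ₀` as above, for `β ≥ 2`,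
`Z(B_n, β) ≤ 2 ∫_{G^{E_n^1}} 1_{‖1 - v_e‖ ≤ ρ₀ ∀ e} e^{-β S(1 on E_n^0, v)} dσ^{E_n^1}(v)`.
Proof as printed: Cor. 8.2, Cor. 9.4 (gauge fixing) and the discrete Poincaré inequality Lemma 10.2
(`‖1 - U(x,y)‖² ≤ 2|x|₁ S ≤ 2 d n S`). [cite: arXiv160201222, Thm. 10.1] -/
theorem Z_le_two_mul_lintegral_free {C : ℝ}
    (hC : ∀ (n : ℕ) (β : ℝ), 2 ≤ β → ENNReal.ofReal (Real.exp (-(C * n ^ d * Real.log β))) ≤ Z d N n β)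
    (n : ℕ) {β : ℝ} (hβ : 2 ≤ β) :
    Z d N n β ≤ 2 * ∫⁻ v in Set.pi Set.univ (fun _ => gball N (rho0 C d n β)),
      ENNReal.ofReal (Real.exp (-β * S d N n (ext (ext₁ v))))
        ∂(Measure.pi fun _ : {e : ↥(boxEdges d n) // ¬ IsComb e.1} => haarProbability (𝔾 N)) := by
  have hβ0 : 0 < β := by linarith
  set A := {u : BoxCfg d (𝔾 N) n | β * S d N n (ext u) ≤ C * n ^ d * Real.log β + Real.log 2} with hA
  set f := fun u : BoxCfg d (𝔾 N) n => ENNReal.ofReal (Real.exp (-β * S d N n (ext u))) with hf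
  have hAm : MeasurableSet A :=
    measurableSet_le ((measurable_S_ext n).const_mul β) measurable_const
  have hfm : Measurable f :=
    ENNReal.measurable_ofReal.comp (Real.measurable_exp.comp ((measurable_S_ext n).const_mul _))
  -- Cor. 8.2, written with an indicator
  have h1 := Z_le_two_mul_setLIntegral hC n hβ
  rw [← lintegral_indicator hAm] at h1
  -- gauge invariance of the indicator integrand, Cor. 9.4
  have hinv : ∀ u, A.indicator f (gaugeFixBox u) = A.indicator f u := fun u => by
    simp only [Set.indicator, hA, Set.mem_setOf_eq, hf, zdWilsonAction_ext_gaugeFixBox (ρ := ι)]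
  have h2 := lintegral_pi_eq_lintegral_free (hfm.indicator hAm) hinv
  rw [h2] at h1
  refine h1.trans (mul_le_mul_right ?_ 2)
  -- pointwise: on `A`, the free variables are within `ρ₀` of `1` (Lemma 10.2)
  rw [← lintegral_indicator (MeasurableSet.univ_pi fun _ => measurableSet_gball _)]
  refine lintegral_mono fun v => ?_
  by_cases hv : ext₁ v ∈ A
  · rw [Set.indicator_of_mem hv]
    have hT : v ∈ Set.pi Set.univ fun _ => gball N (rho0 C d n β) := by
      intro e _
      rw [mem_gball, ← norm_neg, neg_sub]
      have hPo := norm_one_sub_sq_le_l1_mul_S v e.1.2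
      rw [ext_apply_of_mem _ e.1.2, ext₁_apply_of_not_isComb _ e.2] at hPo
      have hl1 : (l1 (e.1 : ZdEdge d).1 : ℝ) ≤ d * n := by
        exact_mod_cast l1_le (mem_boxEdges.1 e.1.2).1
      have hS := S_nonneg n (ext (ext₁ v))
      simp only [hA, Set.mem_setOf_eq] at hv
      have hsq : ‖(1 : 𝕄) - (v ⟨e.1, e.2⟩ : 𝔾 N)‖ ^ 2 ≤ 2 * d * n * (C * n ^ d * Real.log β + Real.log 2) / β := by
        rw [le_div_iff₀ hβ0]
        calc ‖(1 : 𝕄) - (v ⟨e.1, e.2⟩ : 𝔾 N)‖ ^ 2 * β ≤ 2 * l1 (e.1 : ZdEdge d).1 * S d N n (ext (ext₁ v)) * β :=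
              mul_le_mul_of_nonneg_right hPo hβ0.le
          _ = 2 * l1 (e.1 : ZdEdge d).1 * (β * S d N n (ext (ext₁ v))) := by ring
          _ ≤ 2 * (d * n) * (C * n ^ d * Real.log β + Real.log 2) := by
              gcongr
          _ = 2 * d * n * (C * n ^ d * Real.log β + Real.log 2) := by ring
      calc ‖(1 : 𝕄) - (v e : 𝔾 N)‖ = Real.sqrt (‖(1 : 𝕄) - (v ⟨e.1, e.2⟩ : 𝔾 N)‖ ^ 2) := by
            rw [Real.sqrt_sq (norm_nonneg _)]
        _ ≤ rho0 C d n β := Real.sqrt_le_sqrt hsq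
    rw [Set.indicator_of_mem hT]
  · rw [Set.indicator_of_notMem hv]; exact zero_le

/-! ### Theorem 16.3: the Wilson action in the chart is the Maxwell action up to `O(η³)` -/

/-- `cay(-X) cay(X) = 1`. [folklore] -/
theorem cay_neg_mul_cay {X : 𝕄} (hX : Xᴴ = -X) : cay (-X) * cay X = 1 := by
  have hu := (Matrix.isUnit_iff_isUnit_det _).1 (isUnit_two_sub hX)
  have hu' := (Matrix.isUnit_iff_isUnit_det _).1 (isUnit_two_add hX)
  have e1 : (2 : 𝕄) + -X = 2 - X := (sub_eq_add_neg 2 X).symm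
  have e2 : (2 : 𝕄) - -X = 2 + X := sub_neg_eq_add 2 X
  rw [cay, cay, e1, e2, Matrix.mul_assoc, ← Matrix.mul_assoc ((2 : 𝕄) + X)⁻¹,
    Matrix.nonsing_inv_mul _ hu', Matrix.one_mul, Matrix.mul_nonsing_inv _ hu]

/-- `chart(-a) = chart(a)⁻¹`: reversing an edge negates the chart parameter. [folklore] -/
theorem chart_neg (a : 𝔼 N) : chart (-a) = (chart a)⁻¹ := by
  rw [eq_inv_iff_mul_eq_one]
  ext1
  rw [Submonoid.coe_mul, coe_chart, coe_chart, map_neg, cay_neg_mul_cay (conjTranspose_skewOf a)]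
  rfl

variable (d) in
/-- The index type `E_n^1` of the free (non-comb) edges of `B_n`. [cite: arXiv160201222, §2] -/
abbrev FreeIdx (n : ℕ) : Type := {e : ↥(boxEdges d n) // ¬ IsComb e.1}

variable {n : ℕ}

/-- Extension of chart parameters on the free edges by `0` (on the comb tree and off the box):
the Lie-algebra configuration `H ∈ H_0(B_n)` of §16. [cite: arXiv160201222, §16] -/
def zeroExt (a : FreeIdx d n → 𝔼 N) : ZdEdge d → 𝔼 N := fun e =>
  if h : e ∈ boxEdges d n then (if hc : IsComb e then 0 else a ⟨⟨e, h⟩, hc⟩) else 0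

/-- The plaquette circulation `H(x,j,k) = H(x,x+e_j) + H(x+e_j, x+e_j+e_k) - H(x+e_k+…) - H(x,x+e_k)` of
a Lie-algebra configuration (§16). [cite: arXiv160201222, §16] -/
def circ (H : ZdEdge d → 𝔼 N) (p : Plaq d) : 𝔼 N :=
  H (p.1, p.2.1) + H (p.1 + Pi.single p.2.1 1, p.2.2) - H (p.1 + Pi.single p.2.2 1, p.2.1) - H (p.1, p.2.2)

variable (d N) in
/-- **The (matrix-valued) lattice Maxwell action** `M_n(H) = Σ_{p ∈ B_n'} ‖H(p)‖²` of the
Lie-algebra configuration `H = zeroExt a` (Chatterjee arXiv:1602.01222 §16, `M_n(H)` on `H_0(B_n)`;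
here in the isometric coordinates `ℝ^{N²}` of `UnitaryCayley.skewOf`). [cite: arXiv160201222, §16] -/
def maxwell (n : ℕ) (a : FreeIdx d n → 𝔼 N) : ℝ :=
  ∑ p ∈ plaquettesIn (halfOpenBox d n), ‖circ (zeroExt a) p‖ ^ 2

/-- `maxwell ≥ 0`. [folklore] -/
theorem maxwell_nonneg (n : ℕ) (a : FreeIdx d n → 𝔼 N) : 0 ≤ maxwell d N n a :=
  Finset.sum_nonneg fun _ _ => sq_nonneg _

/-- In the chart, the gauge-fixed configuration is `chart ∘ zeroExt` on every edge of the box. [folklore] -/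
theorem ext_ext₁_chartPi_apply (a : FreeIdx d n → 𝔼 N) {e : ZdEdge d} (he : e ∈ boxEdges d n) :
    ext (ext₁ (chartPi a)) e = chart (zeroExt a e) := by
  rw [ext_apply_of_mem _ he]
  by_cases hc : IsComb e
  · rw [ext₁_apply_of_isComb _ hc]
    simp [zeroExt, he, hc]
  · rw [ext₁_apply_of_not_isComb _ hc]
    simp [zeroExt, he, hc]

/-- The norm of `zeroExt a` is bounded by that of `a`. [folklore] -/
theorem norm_zeroExt_le {a : FreeIdx d n → 𝔼 N} {η : ℝ} (hη : 0 ≤ η) (ha : ∀ e, ‖a e‖ ≤ η)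
    (e : ZdEdge d) : ‖zeroExt a e‖ ≤ η := by
  unfold zeroExt
  split_ifs
  · simpa using hη
  · exact ha _
  · simpa using hη

/-- **Lemma 16.2 on a plaquette of the box**: the plaquette cost of `chart ∘ H` is
`½ ‖H(p)‖² + O(η³)`. [cite: arXiv160201222, Lemma 16.2 (analogue)] -/
theorem abs_plaquetteCost_chart_sub_le {a : FreeIdx d n → 𝔼 N} {η : ℝ} (hη0 : 0 ≤ η) (hη1 : η ≤ 1)
    (ha : ∀ e, ‖a e‖ ≤ η) {p : Plaq d} (hp : p ∈ plaquettesIn (halfOpenBox d n)) :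
    |((N : ℝ) - ((((ext (ext₁ (chartPi a))).plaquette p.1 p.2.1 p.2.2 : 𝔾 N) : 𝕄).trace).re) -
      ‖circ (zeroExt a) p‖ ^ 2 / 2| ≤ 67 * N * η ^ 3 := by
  obtain ⟨h1, h2, h3, h4⟩ := edges_mem_boxEdges hp
  set H := zeroExt a with hH
  have hU : ((ext (ext₁ (chartPi a))).plaquette p.1 p.2.1 p.2.2 : 𝔾 N) =
      chart (H (p.1, p.2.1)) * chart (H (p.1 + Pi.single p.2.1 1, p.2.2)) *
        chart (-H (p.1 + Pi.single p.2.2 1, p.2.1)) * chart (-H (p.1, p.2.2)) := by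
    rw [ZdGaugeConfig.plaquette, ext_ext₁_chartPi_apply a h1, ext_ext₁_chartPi_apply a h2,
      ext_ext₁_chartPi_apply a h3, ext_ext₁_chartPi_apply a h4, chart_neg, chart_neg]
  have htr : ∀ U : 𝔾 N, (N : ℝ) - (((U : 𝔾 N) : 𝕄).trace).re = ((1 - ((U : 𝔾 N) : 𝕄)).trace).re := fun U => by
    rw [trace_sub, Complex.sub_re, trace_one, Fintype.card_fin]; simp
  rw [htr, hU]
  simp only [Submonoid.coe_mul, coe_chart, map_neg]
  have hsk : ∀ z : 𝔼 N, (-skewOf z)ᴴ = -(-skewOf z) := fun z => by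
    rw [conjTranspose_neg, conjTranspose_skewOf]
  have hn : ∀ e, ‖skewOf (H e)‖ ≤ η := fun e => by
    rw [LinearIsometry.norm_map]; exact norm_zeroExt_le hη0 ha e
  have hn' : ∀ e, ‖-skewOf (H e)‖ ≤ η := fun e => by rw [norm_neg]; exact hn e
  have key := abs_re_trace_one_sub_cay_prod_sub_le (conjTranspose_skewOf (H (p.1, p.2.1)))
    (conjTranspose_skewOf (H (p.1 + Pi.single p.2.1 1, p.2.2))) (hsk (H (p.1 + Pi.single p.2.2 1, p.2.1)))
    (hsk (H (p.1, p.2.2))) hη1 (hn _) (hn _) (hn' _) (hn' _)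
  have hsum : skewOf (H (p.1, p.2.1)) + skewOf (H (p.1 + Pi.single p.2.1 1, p.2.2)) +
      -skewOf (H (p.1 + Pi.single p.2.2 1, p.2.1)) + -skewOf (H (p.1, p.2.2)) = skewOf (circ H p) := by
    simp only [circ, map_add, map_sub]; abel
  rw [hsum, LinearIsometry.norm_map] at key
  exact key

/-- **Theorem 16.3 (from the Wilson action to the Maxwell action)** in the Cayley chart: if all
chart parameters have norm `≤ η ≤ 1`, then `|S_{B_n}(chart ∘ H) - ½ M_n(H)| ≤ 67 N η³ |B_n'|`. [cite: arXiv160201222, Thm. 16.3 (analogue)] -/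
theorem abs_S_chart_sub_maxwell_le {a : FreeIdx d n → 𝔼 N} {η : ℝ} (hη0 : 0 ≤ η) (hη1 : η ≤ 1)
    (ha : ∀ e, ‖a e‖ ≤ η) :
    |S d N n (ext (ext₁ (chartPi a))) - maxwell d N n a / 2| ≤
      67 * N * η ^ 3 * #(plaquettesIn (halfOpenBox d n)) := by
  unfold S zdWilsonAction maxwell
  rw [Finset.sum_div, ← Finset.sum_sub_distrib]
  refine (Finset.abs_sum_le_sum_abs _ _).trans ?_
  calc ∑ p ∈ plaquettesIn (halfOpenBox d n), |((N : ℝ) - ((unitaryFundamentalRep (Fin N) ℂ)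
          ((ext (ext₁ (chartPi a))).plaquette p.1 p.2.1 p.2.2)).trace.re) - ‖circ (zeroExt a) p‖ ^ 2 / 2|
      ≤ ∑ _p ∈ plaquettesIn (halfOpenBox d n), 67 * N * η ^ 3 :=
        Finset.sum_le_sum fun p hp => by
          rw [unitaryFundamentalRep_apply]; exact abs_plaquetteCost_chart_sub_le hη0 hη1 ha hp
    _ = 67 * N * η ^ 3 * #(plaquettesIn (halfOpenBox d n)) := by
        rw [Finset.sum_const, nsmul_eq_mul]; ring

/-- `maxwell` is continuous in the chart parameters. [folklore] -/
theorem continuous_maxwell (n : ℕ) : Continuous (maxwell d N n) := by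
  unfold maxwell circ zeroExt
  refine continuous_finsetSum _ fun p _ => ?_
  refine (Continuous.norm ?_).pow 2
  have hc : ∀ e : ZdEdge d, Continuous fun a : FreeIdx d n → 𝔼 N =>
      (if h : e ∈ boxEdges d n then (if hc : IsComb e then (0 : 𝔼 N) else a ⟨⟨e, h⟩, hc⟩) else 0) := by
    intro e
    split_ifs
    · exact continuous_const
    · exact continuous_apply _
    · exact continuous_const
  exact (((hc (p.1, p.2.1)).add (hc (p.1 + Pi.single p.2.1 1, p.2.2))).sub
    (hc (p.1 + Pi.single p.2.2 1, p.2.1))).sub (hc (p.1, p.2.2))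

/-! ### Lemmas 17.2 and 17.6 up to the Gaussian integral -/

/-- The weight `e^{-β S}` of the gauge-fixed configuration as a measurable function of the free
variables. [folklore] -/
theorem measurable_weight_free (n : ℕ) (β : ℝ) :
    Measurable fun v : FreeCfg d (𝔾 N) n => ENNReal.ofReal (Real.exp (-β * S d N n (ext (ext₁ v)))) :=
  ENNReal.measurable_ofReal.comp (Real.measurable_exp.comp
    (((measurable_S_ext n).comp measurable_ext₁).const_mul _))

/-- `κ(1/4) ≤ 2`, so `B(1, ρ₀) ⊆ chart(b(0, 2ρ₀))` for `ρ₀ ≤ 1/8`. [folklore] -/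
theorem gball_subset_image_chart_two_mul {ρ : ℝ} (hρ0 : 0 ≤ ρ) (hρ : ρ ≤ 1 / 8) :
    gball N ρ ⊆ chart '' Metric.closedBall (0 : 𝔼 N) (2 * ρ) := by
  refine (gball_mono ?_).trans (gball_subset_image_chart (by linarith) (by linarith))
  have hκ : κ (2 * ρ) ≤ 2 := by
    unfold κ; nlinarith
  rw [le_div_iff₀ (κ_pos (by linarith))]
  nlinarith

/-- On the product ball of radius `r ≤ 1` the chart weight is comparable with the Maxwell weight
(Thm. 16.3): `e^{-βS(chart a)} ≤ e^{67 β N r³ |B_n'|} e^{-β M(a)/2}`. [cite: arXiv160201222, Thm. 16.3 (analogue)] -/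
theorem weight_chartPi_le {n : ℕ} {β r : ℝ} (hβ : 0 ≤ β) (hr0 : 0 ≤ r) (hr1 : r ≤ 1)
    {a : FreeIdx d n → 𝔼 N} (ha : a ∈ Set.pi Set.univ fun _ => Metric.closedBall (0 : 𝔼 N) r) :
    ENNReal.ofReal (Real.exp (-β * S d N n (ext (ext₁ (chartPi a))))) ≤
      ENNReal.ofReal (Real.exp (67 * β * N * r ^ 3 * #(plaquettesIn (halfOpenBox d n)))) *
        ENNReal.ofReal (Real.exp (-β * maxwell d N n a / 2)) := by
  have ha' : ∀ e, ‖a e‖ ≤ r := fun e => by simpa using ha e (Set.mem_univ _)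
  have h := (abs_le.1 (abs_S_chart_sub_maxwell_le hr0 hr1 ha')).1
  rw [← ENNReal.ofReal_mul (Real.exp_pos _).le, ← Real.exp_add]
  apply ENNReal.ofReal_le_ofReal
  apply Real.exp_le_exp.2
  nlinarith

/-- … and conversely `e^{-βS(chart a)} ≥ e^{-67 β N r³ |B_n'|} e^{-β M(a)/2}`. [cite: arXiv160201222, Thm. 16.3 (analogue)] -/
theorem le_weight_chartPi {n : ℕ} {β r : ℝ} (hβ : 0 ≤ β) (hr0 : 0 ≤ r) (hr1 : r ≤ 1)
    {a : FreeIdx d n → 𝔼 N} (ha : a ∈ Set.pi Set.univ fun _ => Metric.closedBall (0 : 𝔼 N) r) :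
    ENNReal.ofReal (Real.exp (-(67 * β * N * r ^ 3 * #(plaquettesIn (halfOpenBox d n))))) *
        ENNReal.ofReal (Real.exp (-β * maxwell d N n a / 2)) ≤
      ENNReal.ofReal (Real.exp (-β * S d N n (ext (ext₁ (chartPi a))))) := by
  have ha' : ∀ e, ‖a e‖ ≤ r := fun e => by simpa using ha e (Set.mem_univ _)
  have h := (abs_le.1 (abs_S_chart_sub_maxwell_le hr0 hr1 ha')).2
  rw [← ENNReal.ofReal_mul (Real.exp_pos _).le, ← Real.exp_add]
  apply ENNReal.ofReal_le_ofReal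
  apply Real.exp_le_exp.2
  nlinarith

/-- Continuity of the Maxwell weight. [folklore] -/
theorem measurable_maxwellWeight (n : ℕ) (β : ℝ) :
    Measurable fun a : FreeIdx d n → 𝔼 N => ENNReal.ofReal (Real.exp (-β * maxwell d N n a / 2)) :=
  ENNReal.measurable_ofReal.comp (Real.measurable_exp.comp
    (((continuous_maxwell n).measurable.const_mul _).div_const _))

/-- **Lemma 17.2 up to the Gaussian integral (upper bound at fixed box size)**: with `C` from
Thm. 7.1, `β ≥ 2` and `ρ₀ = ρ₀(C, d, n, β) ≤ 1/8`,
`Z(B_n, β) ≤ 2 c_N^{|E_n^1|} e^{67 β N (2ρ₀)³ |B_n'|} ∫_{(ℝ^{N²})^{E_n^1}} e^{-β M_n(a)/2} da`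
(Thm. 10.1, the chart comparison `UnitaryCayley.lintegral_pi_image_chart_le`, Thm. 16.3; the
printed lemma then evaluates the Gaussian integral as `β^{-N²|E_n^1|/2} Z_M(B_n)^{N²}`). [cite: arXiv160201222, Lemma 17.2] -/
theorem Z_le_gaussian {C : ℝ}
    (hC : ∀ (n : ℕ) (β : ℝ), 2 ≤ β → ENNReal.ofReal (Real.exp (-(C * n ^ d * Real.log β))) ≤ Z d N n β)
    (n : ℕ) {β : ℝ} (hβ : 2 ≤ β) (hρ : rho0 C d n β ≤ 1 / 8) :
    Z d N n β ≤ 2 * ((haarChartConst N : ℝ≥0∞) ^ Fintype.card (FreeIdx d n) *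
      (ENNReal.ofReal (Real.exp (67 * β * N * (2 * rho0 C d n β) ^ 3 * #(plaquettesIn (halfOpenBox d n)))) *
        ∫⁻ a : FreeIdx d n → 𝔼 N, ENNReal.ofReal (Real.exp (-β * maxwell d N n a / 2)))) := by
  have hβ0 : 0 ≤ β := by linarith
  set ρ := rho0 C d n β with hρdef
  have hρ0 : 0 ≤ ρ := rho0_nonneg C d n β
  set r := 2 * ρ with hr
  have hr0 : 0 ≤ r := by positivity
  have hr1 : r ≤ 1 := by linarith
  set f := fun v : FreeCfg d (𝔾 N) n => ENNReal.ofReal (Real.exp (-β * S d N n (ext (ext₁ v)))) with hf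
  have hfm : Measurable f := measurable_weight_free n β
  refine (Z_le_two_mul_lintegral_free hC n hβ).trans (mul_le_mul_right ?_ 2)
  -- Step 2: enlarge the domain to the product of chart images
  have hsub : (Set.pi Set.univ fun _ : FreeIdx d n => gball N ρ) ⊆
      Set.pi Set.univ fun _ => chart '' Metric.closedBall (0 : 𝔼 N) r :=
    Set.pi_mono fun _ _ => gball_subset_image_chart_two_mul hρ0 hρ
  refine (lintegral_mono_set hsub).trans ?_
  -- Step 3: chart comparison
  refine (lintegral_pi_image_chart_le (Metric.closedBall (0 : 𝔼 N) r) hfm).trans (mul_le_mul_right ?_ _)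
  -- Step 4: Thm 16.3 on the ball, then drop the ball
  calc ∫⁻ a in Set.pi Set.univ (fun _ => Metric.closedBall (0 : 𝔼 N) r), f (chartPi a)
      ≤ ∫⁻ a in Set.pi Set.univ (fun _ => Metric.closedBall (0 : 𝔼 N) r),
          ENNReal.ofReal (Real.exp (67 * β * N * r ^ 3 * #(plaquettesIn (halfOpenBox d n)))) *
            ENNReal.ofReal (Real.exp (-β * maxwell d N n a / 2)) :=
        setLIntegral_mono ((measurable_maxwellWeight n β).const_mul _) fun a ha => weight_chartPi_le hβ0 hr0 hr1 ha
    _ = ENNReal.ofReal (Real.exp (67 * β * N * r ^ 3 * #(plaquettesIn (halfOpenBox d n)))) *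
          ∫⁻ a in Set.pi Set.univ (fun _ => Metric.closedBall (0 : 𝔼 N) r),
            ENNReal.ofReal (Real.exp (-β * maxwell d N n a / 2)) :=
        lintegral_const_mul _ (measurable_maxwellWeight n β)
    _ ≤ _ := mul_le_mul_right (setLIntegral_le_lintegral _ _) _

/-- **Lemma 17.6 up to the Gaussian integral (lower bound at fixed box size)**: for `β ≥ 0` and
`0 < r ≤ 1/2`,
`Z(B_n, β) ≥ (c_N κ(r)^{-N²})^{|E_n^1|} e^{-67 β N r³ |B_n'|} ∫_{b(0,r)^{E_n^1}} e^{-β M_n(a)/2} da`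
(Cor. 9.4, the chart comparison `UnitaryCayley.le_lintegral_pi_image_chart`, Thm. 16.3; the
printed lemma continues with the Gaussian estimates of §14). [cite: arXiv160201222, Lemma 17.6] -/
theorem gaussian_le_Z (n : ℕ) {β : ℝ} (hβ : 0 ≤ β) {r : ℝ} (hr : 0 < r) (hr2 : r ≤ 1 / 2) :
    lowerConst N r ^ Fintype.card (FreeIdx d n) *
      (ENNReal.ofReal (Real.exp (-(67 * β * N * r ^ 3 * #(plaquettesIn (halfOpenBox d n))))) *
        ∫⁻ a in Set.pi Set.univ (fun _ : FreeIdx d n => Metric.closedBall (0 : 𝔼 N) r),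
          ENNReal.ofReal (Real.exp (-β * maxwell d N n a / 2))) ≤ Z d N n β := by
  have hr1 : r ≤ 1 := by linarith
  set f := fun v : FreeCfg d (𝔾 N) n => ENNReal.ofReal (Real.exp (-β * S d N n (ext (ext₁ v)))) with hf
  have hfm : Measurable f := measurable_weight_free n β
  -- gauge fixing: `Z = ∫ f dσ^{E¹}`
  have hZ : Z d N n β = ∫⁻ v, f v ∂(Measure.pi fun _ : FreeIdx d n => haarProbability (𝔾 N)) := by
    rw [Z_eq]
    exact lintegral_pi_eq_lintegral_free (ENNReal.measurable_ofReal.comp (Real.measurable_exp.comp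
      ((measurable_S_ext n).const_mul _))) fun u => by simp only [zdWilsonAction_ext_gaugeFixBox (ρ := ι)]
  rw [hZ]
  refine le_trans ?_ (setLIntegral_le_lintegral (Set.pi Set.univ fun _ => chart '' Metric.closedBall (0 : 𝔼 N) r) _)
  refine le_trans ?_ (le_lintegral_pi_image_chart hr hr2 hfm)
  refine mul_le_mul_right ?_ _
  calc ENNReal.ofReal (Real.exp (-(67 * β * N * r ^ 3 * #(plaquettesIn (halfOpenBox d n))))) *
        ∫⁻ a in Set.pi Set.univ (fun _ : FreeIdx d n => Metric.closedBall (0 : 𝔼 N) r),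
          ENNReal.ofReal (Real.exp (-β * maxwell d N n a / 2))
      = ∫⁻ a in Set.pi Set.univ (fun _ : FreeIdx d n => Metric.closedBall (0 : 𝔼 N) r),
          ENNReal.ofReal (Real.exp (-(67 * β * N * r ^ 3 * #(plaquettesIn (halfOpenBox d n))))) *
            ENNReal.ofReal (Real.exp (-β * maxwell d N n a / 2)) :=
        (lintegral_const_mul _ (measurable_maxwellWeight n β)).symm
    _ ≤ ∫⁻ a in Set.pi Set.univ (fun _ : FreeIdx d n => Metric.closedBall (0 : 𝔼 N) r), f (chartPi a) :=
        setLIntegral_mono (hfm.comp measurable_chartPi) fun a ha => le_weight_chartPi hβ hr.le hr1 ha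

end WilsonWeakCoupling

end Literature.MathematicalPhysics.QuantumFieldTheory
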